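import Literature.MathematicalPhysics.QuantumLattice.HubbardCouplingTransport
import Literature.MathematicalPhysics.QuantumLattice.HubbardTwoPointSource
import Literature.MathematicalPhysics.QuantumLattice.HubbardFermiLiquidProofs
import Literature.MathematicalPhysics.QuantumLattice.HubbardLatticeActivity
import Literature.Probability.LatticeModels.AnchoredClusterExpansion
import Literature.Probability.LatticeModels.TorusCentredLift
import Literature.Probability.LatticeModels.PolymerPressureAnalytic
import Literature.Probability.LatticeModels.PolymerGasRatio
import Mathlib.Analysis.Complex.Liouville
import HarnessLib

/-!
# The high-temperature corner of `bgm_two_point_limit`: thermodynamic limit of the Hubbard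
two-point function on the torus for `β ≤ β₀`, all `U`, `μ` (Ueltschi 1999, Thm. 2.1 (ii), periodic b.c.)

Programme under the named fact `bgm_two_point_limit` (`HubbardFermiLiquid.lean`;
Benfatto–Giuliani–Mastropietro 2006, Thm. 1.1: convergence of `⟨c†_{xσ} c_{yσ'}⟩_{β,L}` as `L → ∞`
for `0 < β ≤ e^{c/|U|}`, `|U| ≤ U₀`). This file PROVES the conclusion of the fact on the
high-temperature part `0 < β ≤ β₀` of its hypothesis region — for ALL real `U, μ` — by the polymer
(cluster) expansion of Ueltschi (J. Stat. Phys. 95 (1999) 693, Thm. 2.1 (ii): "the Gibbs state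
converges weakly in the thermodynamic limit", proof p. 5: "The limit exists, because the sums
converge uniformly in the volume"), here with periodic instead of free boundary conditions
("periodic interactions could be considered with only small modifications", loc. cit. §2.1):

* `exists_tendsto_hubbardThermalTwoPoint_of_le_betaHT` — for `0 ≤ β ≤ betaHT`,
  `betaHT = (4 · 35² · e⁶)⁻¹`, and all `U μ x y σ σ'`, the finite-volume two-point function
  `hubbardThermalTwoPoint β U μ L x y σ σ'` converges as `L → ∞`;
* `bgm_two_point_limit_of_le_betaHT` — the same in the quantifier shape of the fact.

## The proof (sources inserted, anchored cluster expansion, Cauchy estimate)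

Everything except the last section is written for a GENERIC "source gas": a finite graph `G`
(degree `≤ 4`) on a finite linearly ordered site set, hopping `t = 1` at inverse temperature `β`,
and one source bond `b₀` with complex strength `ε` (`srcCoupling G β b₀ ε = β·1_{bonds G} + ε δ_{b₀}`,
polymer activities `srcActivity = couplingActivity (bonds ∪ {b₀}) …` of `HubbardCouplingWeights.lean`):
(1) `Zc(c^ε) = z₀^{|Λ|} Ξ(ρ^ε)` and, for `β, |ε| ≤ betaHT`, `ρ^ε` is a small activity
(`IsSmallActivity`, `δ = 1`), so the KP logarithm `F(ε) = log Ξ(ρ^ε)` (`srcLogZ`) is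
complex-differentiable on `|ε| < betaHT` with `F'(0) = Zc'(0)/Zc(0) = ⟨c†_{b₀.1} c_{b₀.2}⟩`
(`deriv_srcLogZ_zero`; `HubbardTwoPointSource.lean`);
(2) `F(ε) - F(0) = Σ_{C anchored} (Φ^T(C; ρ^ε) - Φ^T(C; ρ^0))` over the families `C` meeting a polymer
containing both sites of `b₀` (`AnchoredClusterExpansion.lean`), split into `‖C‖ < R` (main part
`srcMain`) and `‖C‖ ≥ R` (tail `srcTail`, `≤ e^{-R}` by the KP estimate at `{b₀.1}`);
(3) TRANSPORT: along an injective site map intertwining graphs and source bonds the activities and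
truncated functionals agree (`srcActivity_map_inj`, `truncatedWeight_srcActivity_map`;
`HubbardCouplingTransport.lean`), and GEOMETRY: for a height function growing by at most one along
the edges of `G` and vanishing at the sites of `b₀`, anchored families of size `< R` with `Φ^T ≠ 0`
have support of height `< R` (`height_lt_of_mem_srcFamilies`).
Then for the torus `(ℤ/Lℤ)²` with `b₀ = (0̄, ȳ, σ)` (translation invariance, `FermionRelabelling.lean`,
reduces `x` to `0`; unequal spins give `0`): with the torus distance to `{0̄, ȳ}` as height
(`TorusCentredLift.lean`) the main part equals, for `L > 2(R + ‖y‖_∞) + 1`, the same sum computed in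
the centred box `Λ_{R+‖y‖_∞}` of `ℤ²` (`srcMain_torus_eq_plane`), hence does not depend on `L`;
(4) so `|(F_L(ε)-F_L(0)) - (F_{L'}(ε)-F_{L'}(0))| ≤ 4e^{-R}` on `|ε| ≤ betaHT`, and Cauchy's estimate on
`|ε| = betaHT/2` gives `|⟨·⟩_L - ⟨·⟩_{L'}| ≤ 8 e^{-R}/betaHT`: the sequence is Cauchy, hence convergent.

## References

* D. Ueltschi, J. Stat. Phys. 95 (1999) 693 (arXiv:cond-mat/9810320), Thm. 2.1 (ii) and its proof
  p. 5; Thm. 3.1 (Hubbard model). [Ueltschi1999]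
* R. Kotecký, D. Preiss, Comm. Math. Phys. 103 (1986) 491, Theorem and Proposition (i). [KoteckyPreiss1986]
* G. Benfatto, A. Giuliani, V. Mastropietro, Ann. Henri Poincaré 7 (2006) 809, Thm. 1.1 (the fact;
  this file covers only its high-temperature corner). [BenfattoGiulianiMastropietro2006]
-/

noncomputable section

namespace Literature.MathematicalPhysics.QuantumLattice

open Matrix Finset HubbardWave0 Literature.Probability.LatticeModels Filter
open scoped _root_.Topology

namespace SourceGas

/-! ## The generic source gas -/

section Generic

variable {Λ : Type*} [LinearOrder Λ] [Fintype Λ]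

/-- The active bonds: the bonds of the graph and the source bond. [cite: Ueltschi1999, proof of Thm. 2.1 (ii) (the sets supp K, A₁, …, A_m)] -/
def srcBonds (G : SimpleGraph Λ) [DecidableRel G.Adj] (b₀ : Bond Λ) : Finset (Bond Λ) := hubbardBonds G ∪ {b₀}

/-- The couplings `β · 1_{bonds G} + ε δ_{b₀}` (hopping `t = 1` at inverse temperature `β`, source of
strength `ε` on `b₀`). [cite: Ueltschi1999, proof of Thm. 2.1 (ii)] -/
def srcCoupling (G : SimpleGraph Λ) [DecidableRel G.Adj] (β : ℝ) (b₀ : Bond Λ) (ε : ℂ) : Bond Λ → ℂ :=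
  hubbardCoupling G (β : ℂ) + ε • (Pi.single b₀ 1 : Bond Λ → ℂ)

/-- The polymer activities of the source gas. [cite: Ueltschi1999, §2.3 and proof of Thm. 2.1 (ii) (ρ, ρ_K)] -/
def srcActivity (G : SimpleGraph Λ) [DecidableRel G.Adj] (β U μ : ℝ) (b₀ : Bond Λ) (ε : ℂ) : Finset Λ → ℂ :=
  couplingActivity (srcBonds G b₀) (β : ℂ) (U : ℂ) (μ : ℂ) (srcCoupling G β b₀ ε)

/-- The Kotecký–Preiss logarithm `F(ε) = log Ξ(ρ^ε)` of the source gas. [cite: KoteckyPreiss1986, §2 (log 𝒵)] -/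
def srcLogZ (G : SimpleGraph Λ) [DecidableRel G.Adj] (β U μ : ℝ) (b₀ : Bond Λ) (ε : ℂ) : ℂ :=
  polymerLogZ polyInc (srcActivity G β U μ b₀ ε) (Finset.univ : Finset Λ).powerset

variable {G : SimpleGraph Λ} [DecidableRel G.Adj] {β U μ : ℝ} {b₀ : Bond Λ}

omit [Fintype Λ] in
/-- The couplings in coordinates. [folklore] -/
theorem srcCoupling_apply (ε : ℂ) (b : Bond Λ) :
    srcCoupling G β b₀ ε b = (if G.Adj b.1 b.2.1 then (β : ℂ) else 0) + (if b = b₀ then ε else 0) := by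
  rw [srcCoupling, Pi.add_apply, hubbardCoupling_apply, Pi.smul_apply, smul_eq_mul]
  congr 1
  by_cases hb : b = b₀
  · rw [hb, Pi.single_eq_same, mul_one, if_pos rfl]
  · rw [Pi.single_eq_of_ne hb, mul_zero, if_neg hb]

/-- Membership in the active bonds. [folklore] -/
theorem mem_srcBonds {b : Bond Λ} : b ∈ srcBonds G b₀ ↔ G.Adj b.1 b.2.1 ∨ b = b₀ := by
  rw [srcBonds, Finset.mem_union, Finset.mem_singleton, mem_hubbardBonds]

/-- The couplings vanish off the active bonds. [folklore] -/
theorem srcCoupling_eq_zero_of_not_mem {ε : ℂ} {b : Bond Λ} (hb : b ∉ srcBonds G b₀) : srcCoupling G β b₀ ε b = 0 := by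
  rw [mem_srcBonds, not_or] at hb
  rw [srcCoupling_apply, if_neg hb.1, if_neg hb.2, add_zero]

/-- The couplings are supported on the active bonds. [folklore] -/
theorem couplingRestrict_srcCoupling (ε : ℂ) : couplingRestrict (srcCoupling G β b₀ ε) (srcBonds G b₀) = srcCoupling G β b₀ ε := by
  funext b
  rw [couplingRestrict_apply]
  by_cases hb : b ∈ srcBonds G b₀
  · rw [if_pos hb]
  · rw [if_neg hb, srcCoupling_eq_zero_of_not_mem hb]

omit [Fintype Λ] in
/-- Size of the couplings: `|c_b| ≤ β + |ε|` for `β ≥ 0`. [folklore] -/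
theorem norm_srcCoupling_le (hβ : 0 ≤ β) (ε : ℂ) (b : Bond Λ) : ‖srcCoupling G β b₀ ε b‖ ≤ β + ‖ε‖ := by
  rw [srcCoupling_apply]
  refine (norm_add_le _ _).trans (add_le_add ?_ ?_)
  · split_ifs
    · rw [Complex.norm_real, Real.norm_eq_abs, abs_of_nonneg hβ]
    · rw [norm_zero]; exact hβ
  · split_ifs
    · exact le_rfl
    · rw [norm_zero]; exact norm_nonneg _

omit [Fintype Λ] in
/-- Two source strengths give couplings differing only at the source bond. [folklore] -/
theorem srcCoupling_eq_of_ne {ε ε' : ℂ} {b : Bond Λ} (hb : b ≠ b₀) : srcCoupling G β b₀ ε b = srcCoupling G β b₀ ε' b := by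
  rw [srcCoupling_apply, srcCoupling_apply, if_neg hb, if_neg hb]

/-- For real parameters the one-site partition function does not vanish. [folklore] -/
theorem atomicPartitionFn_real_ne_zero (β U μ : ℝ) : atomicPartitionFn (β : ℂ) (U : ℂ) (μ : ℂ) ≠ 0 := by
  rw [atomicPartitionFn_ofReal]
  exact_mod_cast (atomicPartitionFnReal_pos β U μ).ne'

/-- **The polymer representation of the source-inserted Gibbs factor**: `Zc(c^ε) = z₀^{|Λ|} Ξ(ρ^ε)`.
[cite: Ueltschi1999, §2.3 (polymer form of Tr e^{-βH_Λ})] -/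
theorem Zc_srcCoupling (ε : ℂ) :
    Zc (β : ℂ) (U : ℂ) (μ : ℂ) (srcCoupling G β b₀ ε) =
      atomicPartitionFn (β : ℂ) (U : ℂ) (μ : ℂ) ^ Fintype.card Λ *
        polymerPartitionFunction polyInc (srcActivity G β U μ b₀ ε) (Finset.univ : Finset Λ).powerset := by
  rw [← couplingRestrict_srcCoupling ε, Zc_couplingRestrict_eq_mul_polymerPartitionFunction (atomicPartitionFn_real_ne_zero β U μ)]
  rfl

/-! ### Bond counts and smallness -/

/-- If every vertex has at most `4` neighbours, every site lies on at most `17` active bonds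
(`16` graph bonds and possibly the source). [folklore] -/
theorem card_filter_srcBonds_le (hdeg : ∀ v : Λ, (Finset.univ.filter (G.Adj v)).card ≤ 4) (v : Λ) :
    ((srcBonds G b₀).filter fun b => v ∈ Bond.verts b).card ≤ 17 := by
  rw [srcBonds, Finset.filter_union]
  refine (Finset.card_union_le _ _).trans ?_
  have h1 := card_hubbardBonds_mem_verts_le hdeg v
  have h2 : (({b₀} : Finset (Bond Λ)).filter fun b => v ∈ Bond.verts b).card ≤ 1 :=
    (Finset.card_filter_le _ _).trans (Finset.card_singleton _).le
  omega

/-- **The high-temperature threshold** `β₀ = (4 · 35² · e⁶)⁻¹` of this file (the smallness needed by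
`sum_norm_couplingActivity_mul_exp_le` with `17` bonds per site and couplings `≤ 2β₀`). [folklore] -/
def betaHT : ℝ := 1 / (4 * 35 ^ 2 * Real.exp 6)

/-- `β₀ > 0`. [folklore] -/
theorem betaHT_pos : 0 < betaHT := by unfold betaHT; positivity

/-- `2β₀ ≤ 1`. [folklore] -/
theorem two_mul_betaHT_le_one : 2 * betaHT ≤ 1 := by
  have h6 : (1 : ℝ) ≤ Real.exp 6 := Real.one_le_exp (by norm_num)
  have hpos : (0 : ℝ) < 4 * 35 ^ 2 * Real.exp 6 := by positivity
  rw [betaHT, mul_one_div, div_le_one hpos]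
  nlinarith

/-- The smallness hypothesis of `sum_norm_couplingActivity_mul_exp_le` at `m = 17`, `r₀ = 1`,
`δ = 2β₀` holds (with equality). [folklore] -/
theorem smallness_betaHT : ((2 * 17 : ℕ) + 1 : ℝ) ^ 2 * (Real.exp 6 * 1 ^ 2 * (2 * betaHT)) ≤ 1 / 2 := by
  have he : 0 < Real.exp 6 := Real.exp_pos 6
  rw [show ((2 * 17 : ℕ) + 1 : ℝ) = 35 by norm_num, betaHT]
  field_simp
  nlinarith

/-- And then `2 · 17 · λ ≤ 1`, `λ = e⁶ · 2β₀`. [folklore] -/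
theorem two_mul_seventeen_mul_le_one : 2 * 17 * (Real.exp 6 * 1 ^ 2 * (2 * betaHT)) ≤ 1 := by
  have he : 0 < Real.exp 6 := Real.exp_pos 6
  rw [betaHT]
  field_simp
  nlinarith

/-- **Smallness of the activities**: if degrees are `≤ 4`, `0 ≤ β ≤ β₀` and `|ε| ≤ β₀`, the activities
of the source gas form a small activity with `δ = 1` (uniformly in the volume, `U`, `μ`, `b₀`).
[cite: Ueltschi1999, §3 (|ρ(𝒜)| ≤ e^{-c|𝒜|} for βt small) and proof of Thm. 2.1 (ii) (bound on ρ_K)] -/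
theorem isSmallActivity_srcActivity (hdeg : ∀ v : Λ, (Finset.univ.filter (G.Adj v)).card ≤ 4)
    (hβ0 : 0 ≤ β) (hβ : β ≤ betaHT) {ε : ℂ} (hε : ‖ε‖ ≤ betaHT) :
    IsSmallActivity (srcActivity G β U μ b₀ ε) 1 where
  rho_empty := couplingActivity_empty _ _
  delta_pos := one_pos
  sum_le_one x 𝒜 h𝒜 := by
    have hδ0 : 0 < 2 * betaHT := by linarith [betaHT_pos]
    have hc : ∀ b ∈ srcBonds G b₀, ‖srcCoupling G β b₀ ε b‖ ≤ 2 * betaHT := fun b _ =>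
      (norm_srcCoupling_le hβ0 ε b).trans (by linarith)
    have hr : siteRatio (β : ℂ) (U : ℂ) (μ : ℂ) ≤ 1 := (siteRatio_ofReal β U μ).le
    have h := sum_norm_couplingActivity_mul_exp_le (D := srcBonds G b₀) (m := 17) (card_filter_srcBonds_le hdeg)
      (atomicPartitionFn_real_ne_zero β U μ) le_rfl hr hδ0 two_mul_betaHT_le_one hc smallness_betaHT x 𝒜 h𝒜
    refine le_trans ?_ (h.trans two_mul_seventeen_mul_le_one)
    refine le_of_eq (Finset.sum_congr rfl fun A _ => ?_)
    rw [srcActivity, show ((1 : ℝ) + 1) * (A.card : ℝ) = 2 * A.card by ring]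

/-- Polymers with non-zero activity are connected through the active bonds. [folklore] -/
theorem isRConnected_of_srcActivity_ne_zero {ε : ℂ} {A : Finset Λ} (hA : srcActivity G β U μ b₀ ε A ≠ 0) :
    IsRConnected (BondRel (srcBonds G b₀)) A :=
  isRConnected_bondRel_of_couplingActivity_ne_zero hA

/-! ### Analyticity in the source and the derivative at zero -/

omit [Fintype Λ] in
/-- The restricted couplings are affine in the source strength. [folklore] -/
theorem couplingRestrict_srcCoupling_eq (ε : ℂ) (K : Finset (Bond Λ)) :
    couplingRestrict (srcCoupling G β b₀ ε) K =
      couplingRestrict (hubbardCoupling G (β : ℂ)) K + ε • couplingRestrict (Pi.single b₀ 1) K := by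
  funext b
  simp only [srcCoupling, Pi.add_apply, Pi.smul_apply, couplingRestrict_apply, smul_eq_mul]
  split_ifs <;> simp

/-- The activities are entire functions of the source strength. [cite: KoteckyPreiss1986, p. 493 ("Φ analytic in some parameter")] -/
theorem differentiable_srcActivity (A : Finset Λ) : Differentiable ℂ fun ε : ℂ => srcActivity G β U μ b₀ ε A := by
  unfold srcActivity
  simp only [couplingActivity_apply, couplingWeight_eq_sum]
  refine Differentiable.fun_sum fun X _ => Differentiable.fun_sum fun K' _ => ?_
  refine (differentiable_const _).mul ?_
  simp_rw [couplingRestrict_srcCoupling_eq]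
  have hlin : Differentiable ℂ fun ε : ℂ =>
      couplingRestrict (hubbardCoupling G (β : ℂ)) K' + ε • couplingRestrict (Pi.single b₀ 1 : Bond Λ → ℂ) K' :=
    (differentiable_const _).add (differentiable_id.smul_const _)
  exact (differentiable_gibbsRatio (β : ℂ) (U : ℂ) (μ : ℂ)).comp hlin

/-- Along the rays `u · ρ^ε`, `u ∈ [0, 1]`, `|ε| ≤ β₀`, no partition function vanishes. [cite: KoteckyPreiss1986, Theorem p. 492 (Z ≠ 0)] -/
theorem polymerPartitionFunction_ray_ne_zero (hdeg : ∀ v : Λ, (Finset.univ.filter (G.Adj v)).card ≤ 4)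
    (hβ0 : 0 ≤ β) (hβ : β ≤ betaHT) {ε : ℂ} (hε : ‖ε‖ ≤ betaHT)
    {u : ℝ} (hu : u ∈ Set.Icc (0 : ℝ) 1) (𝒱 : Finset (Finset Λ)) :
    polymerPartitionFunction polyInc (fun A => (u : ℂ) * srcActivity G β U μ b₀ ε A) 𝒱 ≠ 0 := by
  have hsm := isSmallActivity_srcActivity (U := U) (μ := μ) (b₀ := b₀) hdeg hβ0 hβ hε
  have hKP := IsKPVolume.of_norm_le (hsm.isKPVolume 𝒱)
    (w' := fun A => (u : ℂ) * srcActivity G β U μ b₀ ε A) fun A _ => by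
      rw [norm_mul, Complex.norm_real, Real.norm_eq_abs, abs_of_nonneg hu.1]
      exact mul_le_of_le_one_left (norm_nonneg _) hu.2
  exact polymerPartitionFunction_ne_zero_of_kp hKP Finset.Subset.rfl

/-- **`F` is complex-differentiable on `|ε| < β₀`.** [cite: KoteckyPreiss1986, p. 493 (analyticity of log Z)] -/
theorem differentiableOn_srcLogZ (hdeg : ∀ v : Λ, (Finset.univ.filter (G.Adj v)).card ≤ 4) (hβ0 : 0 ≤ β) (hβ : β ≤ betaHT) :
    DifferentiableOn ℂ (srcLogZ G β U μ b₀) (Metric.ball 0 betaHT) := by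
  refine differentiableOn_polymerLogZ_param (inc := polyInc) (v := fun ε A => srcActivity G β U μ b₀ ε A)
    (Finset.univ : Finset Λ).powerset Metric.isOpen_ball
    (fun A _ => (differentiable_srcActivity A).differentiableOn) fun ε hε u hu => ?_
  exact polymerPartitionFunction_ray_ne_zero hdeg hβ0 hβ (le_of_lt (by simpa using hε)) hu _

/-- `exp F(ε) · z₀^{|Λ|} = Zc(c^ε)` for `|ε| ≤ β₀`. [cite: KoteckyPreiss1986, Theorem p. 492 ((2) and Z ≠ 0)] -/
theorem exp_srcLogZ_mul (hdeg : ∀ v : Λ, (Finset.univ.filter (G.Adj v)).card ≤ 4) (hβ0 : 0 ≤ β) (hβ : β ≤ betaHT)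
    {ε : ℂ} (hε : ‖ε‖ ≤ betaHT) :
    Complex.exp (srcLogZ G β U μ b₀ ε) * atomicPartitionFn (β : ℂ) (U : ℂ) (μ : ℂ) ^ Fintype.card Λ =
      Zc (β : ℂ) (U : ℂ) (μ : ℂ) (srcCoupling G β b₀ ε) := by
  rw [srcLogZ, (isSmallActivity_srcActivity (U := U) (μ := μ) hdeg hβ0 hβ hε).exp_polymerLogZ, Zc_srcCoupling, mul_comm]

/-- **The derivative of `F` at `0` is the thermal expectation of the source observable**:
`F'(0) = ⟨c†_{b₀.1 σ} c_{b₀.2 σ}⟩_{β}`, `σ = b₀.2.2`, in the Gibbs state of `H_G(1, U) - μN`.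
[cite: Ueltschi1999, proof of Thm. 2.1 (ii) (⟨K⟩ from the decorated expansion)] -/
theorem deriv_srcLogZ_zero (hdeg : ∀ v : Λ, (Finset.univ.filter (G.Adj v)).card ≤ 4) (hβ0 : 0 ≤ β) (hβ : β ≤ betaHT) :
    deriv (srcLogZ G β U μ b₀) 0 =
      Matrix.thermalCorr β (hamiltonianWith G 1 U μ) (creation (orb b₀.1 b₀.2.2)) (annihilation (orb b₀.2.1 b₀.2.2)) := by
  have hball : Metric.ball (0 : ℂ) betaHT ∈ 𝓝 (0 : ℂ) := Metric.ball_mem_nhds 0 betaHT_pos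
  have hF : DifferentiableAt ℂ (srcLogZ G β U μ b₀) 0 := (differentiableOn_srcLogZ hdeg hβ0 hβ).differentiableAt hball
  have hZ0 : Zc (β : ℂ) (U : ℂ) (μ : ℂ) (srcCoupling G β b₀ 0) ≠ 0 := by
    rw [← exp_srcLogZ_mul (U := U) (μ := μ) hdeg hβ0 hβ (by rw [norm_zero]; exact betaHT_pos.le)]
    exact mul_ne_zero (Complex.exp_ne_zero _) (pow_ne_zero _ (atomicPartitionFn_real_ne_zero β U μ))
  have hev : ∀ᶠ ε in 𝓝 (0 : ℂ), Complex.exp (srcLogZ G β U μ b₀ ε) * atomicPartitionFn (β : ℂ) (U : ℂ) (μ : ℂ) ^ Fintype.card Λ =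
      Zc (β : ℂ) (U : ℂ) (μ : ℂ) (srcCoupling G β b₀ ε) := by
    filter_upwards [hball] with ε hε
    exact exp_srcLogZ_mul hdeg hβ0 hβ (le_of_lt (by simpa using hε))
  have h := thermalCorr_creation_annihilation_eq_deriv_div G β 1 U μ b₀.1 b₀.2.1 b₀.2.2
  simp only [Complex.ofReal_one, mul_one, Prod.mk.eta] at h
  rw [h, deriv_eq_deriv_div_of_exp_mul_eq hF hZ0 hev]
  unfold srcCoupling
  rw [zero_smul, add_zero]

/-! ### The anchored decomposition and the tails -/

/-- The anchored polymers: those containing both sites of the source bond (the only polymers whose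
activity sees the source). [cite: Ueltschi1999, proof of Thm. 2.1 (ii) (the polymer 𝒜_K ⊇ supp K)] -/
def srcAnchored (b₀ : Bond Λ) : Finset (Finset Λ) :=
  (Finset.univ : Finset Λ).powerset.filter fun A => b₀.1 ∈ A ∧ b₀.2.1 ∈ A

/-- The anchored families: the families of polymers meeting an anchored polymer. [cite: KoteckyPreiss1986, Proposition p. 494 (i)] -/
def srcFamilies (b₀ : Bond Λ) : Finset (Finset (Finset Λ)) :=
  (Finset.univ : Finset Λ).powerset.powerset.filter fun C => (C ∩ srcAnchored b₀).Nonempty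

/-- The total size `‖C‖ = Σ_{A ∈ C} |A|` of a family. [cite: KoteckyPreiss1986, §2 (d(C) = Σ d(γ))] -/
def famSize {α : Type*} (C : Finset (Finset α)) : ℕ := ∑ A ∈ C, A.card

/-- The main part: anchored families of size `< R`. [cite: Ueltschi1999, proof of Thm. 2.1 (iii) ("short" polymers and clusters)] -/
def srcMain (G : SimpleGraph Λ) [DecidableRel G.Adj] (β U μ : ℝ) (b₀ : Bond Λ) (R : ℕ) (ε : ℂ) : ℂ :=
  ∑ C ∈ (srcFamilies b₀).filter (fun C => famSize C < R), truncatedWeight polyInc (srcActivity G β U μ b₀ ε) C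

/-- The tail: anchored families of size `≥ R`. [cite: Ueltschi1999, proof of Thm. 2.1 (iii) ("big" polymers and clusters)] -/
def srcTail (G : SimpleGraph Λ) [DecidableRel G.Adj] (β U μ : ℝ) (b₀ : Bond Λ) (R : ℕ) (ε : ℂ) : ℂ :=
  ∑ C ∈ (srcFamilies b₀).filter (fun C => R ≤ famSize C), truncatedWeight polyInc (srcActivity G β U μ b₀ ε) C

/-- Membership in `srcAnchored`. [folklore] -/
theorem mem_srcAnchored {A : Finset Λ} : A ∈ srcAnchored b₀ ↔ b₀.1 ∈ A ∧ b₀.2.1 ∈ A := by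
  simp [srcAnchored]

/-- Membership in `srcFamilies`. [folklore] -/
theorem mem_srcFamilies {C : Finset (Finset Λ)} : C ∈ srcFamilies b₀ ↔ ∃ A ∈ C, b₀.1 ∈ A ∧ b₀.2.1 ∈ A := by
  simp only [srcFamilies, Finset.mem_filter, Finset.mem_powerset]
  constructor
  · rintro ⟨-, A, hA⟩
    obtain ⟨hAC, hAa⟩ := Finset.mem_inter.1 hA
    exact ⟨A, hAC, mem_srcAnchored.1 hAa⟩
  · rintro ⟨A, hAC, hA⟩
    exact ⟨fun B _ => Finset.mem_powerset.2 (Finset.subset_univ B), A, Finset.mem_inter.2 ⟨hAC, mem_srcAnchored.2 hA⟩⟩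

/-- Off the anchored polymers the activities do not see the source. [cite: Ueltschi1999, proof of Thm. 2.1 (ii)] -/
theorem srcActivity_eq_of_not_mem_anchored {A : Finset Λ} (hA : A ∉ srcAnchored b₀) (ε ε' : ℂ) :
    srcActivity G β U μ b₀ ε A = srcActivity G β U μ b₀ ε' A :=
  couplingActivity_congr_of_not_subset (b₀ := b₀) (fun _ hb => srcCoupling_eq_of_ne hb) (fun h => hA (mem_srcAnchored.2 h))

/-- **The anchored difference formula**: `F(ε) - F(ε') = Σ_{C anchored} (Φ^T(C; ρ^ε) - Φ^T(C; ρ^{ε'}))`.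
[cite: KoteckyPreiss1986, (2) and Proposition p. 494 (i)] -/
theorem srcLogZ_sub (ε ε' : ℂ) :
    srcLogZ G β U μ b₀ ε - srcLogZ G β U μ b₀ ε' =
      ∑ C ∈ srcFamilies b₀, (truncatedWeight polyInc (srcActivity G β U μ b₀ ε) C - truncatedWeight polyInc (srcActivity G β U μ b₀ ε') C) := by
  rw [srcLogZ, srcLogZ, polymerLogZ_sub_eq_sum_filter _ (srcAnchored b₀) (fun A _ hA => srcActivity_eq_of_not_mem_anchored hA ε ε')]
  rfl

/-- Main part plus tail. [folklore] -/
theorem srcLogZ_sub_eq_main_add_tail (R : ℕ) (ε ε' : ℂ) :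
    srcLogZ G β U μ b₀ ε - srcLogZ G β U μ b₀ ε' =
      (srcMain G β U μ b₀ R ε - srcMain G β U μ b₀ R ε') + (srcTail G β U μ b₀ R ε - srcTail G β U μ b₀ R ε') := by
  rw [srcLogZ_sub, Finset.sum_sub_distrib, srcMain, srcMain, srcTail, srcTail]
  have hsplit : ∀ f : Finset (Finset Λ) → ℂ, ∑ C ∈ srcFamilies b₀, f C =
      ∑ C ∈ (srcFamilies b₀).filter (fun C => famSize C < R), f C + ∑ C ∈ (srcFamilies b₀).filter (fun C => R ≤ famSize C), f C := by
    intro f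
    rw [← Finset.sum_filter_add_sum_filter_not (srcFamilies b₀) (fun C => famSize C < R)]
    congr 1
    exact Finset.sum_congr (Finset.filter_congr fun C _ => not_lt) fun _ _ => rfl
  rw [hsplit, hsplit]
  ring

/-- Anchored families contain the first site of the source in their support. [folklore] -/
theorem fst_mem_clusterSupp {C : Finset (Finset Λ)} (hC : C ∈ srcFamilies b₀) : b₀.1 ∈ clusterSupp C := by
  obtain ⟨A, hAC, hA⟩ := mem_srcFamilies.1 hC
  exact mem_clusterSupp.2 ⟨A, hAC, hA.1⟩

/-- **The tail bound**: `|tail(R, ε)| ≤ e^{-R}` for degrees `≤ 4`, `0 ≤ β ≤ β₀`, `|ε| ≤ β₀` (the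
Kotecký–Preiss estimate at the one-site polymer `{b₀.1}`). [cite: KoteckyPreiss1986, Theorem p. 492, estimate (4)] -/
theorem norm_srcTail_le [Countable Λ] (hdeg : ∀ v : Λ, (Finset.univ.filter (G.Adj v)).card ≤ 4) (hβ0 : 0 ≤ β) (hβ : β ≤ betaHT)
    {ε : ℂ} (hε : ‖ε‖ ≤ betaHT) (R : ℕ) :
    ‖srcTail G β U μ b₀ R ε‖ ≤ Real.exp (-R) := by
  have hsmall := isSmallActivity_srcActivity (U := U) (μ := μ) (b₀ := b₀) hdeg hβ0 hβ hε
  have h := hsmall.sum_norm_truncatedWeight_anchored_ge_le b₀.1 (srcFamilies b₀) R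
  rw [one_mul] at h
  refine (norm_sum_le _ _).trans (le_trans ?_ h)
  refine Finset.sum_le_sum_of_subset_of_nonneg (fun C hC => ?_) fun _ _ _ => norm_nonneg _
  obtain ⟨hC, hsize⟩ := Finset.mem_filter.1 hC
  refine Finset.mem_filter.2 ⟨hC, fst_mem_clusterSupp hC, ?_⟩
  rw [← Nat.cast_sum]
  exact_mod_cast hsize

/-! ### Geometry: anchored families of bounded size stay near the source -/

/-- **Anchored families of size `< ‖C‖` stay within height `< ‖C‖`.** Let `ht` grow by at most one
along the edges of `G` and vanish at both sites of `b₀`. If `Φ^T(C; ρ^ε) ≠ 0` for an anchored family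
`C` (degrees `≤ 4`, `0 ≤ β ≤ β₀`, `|ε| ≤ β₀`), then every site of `⋃ C` has height `< ‖C‖`.
[cite: Ueltschi1999, proof of Thm. 2.1 (iii) (polymers and clusters of connected cardinality < d/4)] -/
theorem height_lt_of_mem_srcFamilies (hdeg : ∀ v : Λ, (Finset.univ.filter (G.Adj v)).card ≤ 4) (hβ0 : 0 ≤ β) (hβ : β ≤ betaHT)
    {ε : ℂ} (hε : ‖ε‖ ≤ betaHT) {ht : Λ → ℕ} (hlip : ∀ a b, G.Adj a b → ht b ≤ ht a + 1)
    (h1 : ht b₀.1 = 0) (h2 : ht b₀.2.1 = 0) {C : Finset (Finset Λ)} (hC : C ∈ srcFamilies b₀)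
    (hne : truncatedWeight polyInc (srcActivity G β U μ b₀ ε) C ≠ 0) {w : Λ} (hw : w ∈ clusterSupp C) :
    ht w < famSize C := by
  have hsmall := isSmallActivity_srcActivity (U := U) (μ := μ) (b₀ := b₀) hdeg hβ0 hβ hε
  refine hsmall.height_lt_of_mem_clusterSupp (R := BondRel (srcBonds G b₀)) (fun A hA => isRConnected_of_srcActivity_ne_zero hA)
    (fun a b hab => ?_) hne (fst_mem_clusterSupp hC) h1 hw
  obtain ⟨bd, hbd, ha, hb⟩ := hab
  simp only [Bond.verts, Finset.mem_insert, Finset.mem_singleton] at ha hb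
  rcases mem_srcBonds.1 hbd with hadj | rfl
  · rcases ha with rfl | rfl <;> rcases hb with rfl | rfl
    · exact Nat.le_succ _
    · exact hlip _ _ hadj
    · exact hlip _ _ hadj.symm
    · exact Nat.le_succ _
  · have hb0 : ht b = 0 := by rcases hb with rfl | rfl <;> assumption
    omega

end Generic

/-! ## Transport between two source gases along an injective site map -/

section Transport

variable {Λ Λ' : Type*} [LinearOrder Λ] [Fintype Λ] [LinearOrder Λ'] [Fintype Λ']
variable {G : SimpleGraph Λ} [DecidableRel G.Adj] {G' : SimpleGraph Λ'} [DecidableRel G'.Adj]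
variable (φ : Λ ↪ Λ') {b₀ : Bond Λ} {b₀' : Bond Λ'} {β U μ : ℝ}

omit [Fintype Λ] [Fintype Λ'] in
/-- The couplings are intertwined by an injective site map intertwining graphs and source bonds.
[folklore] -/
theorem srcCoupling_bondMapInj (hG : ∀ p q, G'.Adj (φ p) (φ q) ↔ G.Adj p q) (hb : bondMapInj φ b₀ = b₀') (ε : ℂ) (b : Bond Λ) :
    srcCoupling G' β b₀' ε (bondMapInj φ b) = srcCoupling G β b₀ ε b := by
  rw [srcCoupling_apply, srcCoupling_apply, bondMapInj_apply]
  have hiff : ((φ b.1, φ b.2.1, b.2.2) = b₀') ↔ b = b₀ := by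
    rw [← hb, ← bondMapInj_apply φ b]
    exact (bondMapInj φ).injective.eq_iff
  simp only [hG, hiff]

/-- **Transport of the activities**: along an injective site map `φ` carrying the edges of `G` onto
the edges of `G'` among image points and `b₀` to `b₀'`, `ρ'(φ A) = ρ(A)` for every polymer `A`.
[cite: Ueltschi1999, §2.3 (ρ(𝒜) only involves the sites of 𝒜; periodic weights)] -/
theorem srcActivity_map_inj (hG : ∀ p q, G'.Adj (φ p) (φ q) ↔ G.Adj p q) (hb : bondMapInj φ b₀ = b₀') (ε : ℂ) (A : Finset Λ) :
    srcActivity G' β U μ b₀' ε (A.map φ) = srcActivity G β U μ b₀ ε A := by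
  refine couplingActivity_map_inj φ (atomicPartitionFn_real_ne_zero β U μ) (fun b' hb' => ?_) (fun b' hb' h1 h2 => ?_)
    (fun b _ => srcCoupling_bondMapInj φ hG hb ε b) A
  · obtain ⟨b, hbD, rfl⟩ := Finset.mem_map.1 hb'
    rcases mem_srcBonds.1 hbD with hadj | rfl
    · exact mem_srcBonds.2 (Or.inl (by rw [bondMapInj_apply]; exact (hG _ _).2 hadj))
    · exact mem_srcBonds.2 (Or.inr hb)
  · obtain ⟨p, -, hp⟩ := Finset.mem_map.1 h1
    obtain ⟨q, -, hq⟩ := Finset.mem_map.1 h2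
    have hb'eq : b' = bondMapInj φ (p, q, b'.2.2) := by
      rw [bondMapInj_apply, hp, hq]
    rcases mem_srcBonds.1 hb' with hadj | rfl
    · refine Finset.mem_map.2 ⟨(p, q, b'.2.2), mem_srcBonds.2 (Or.inl ((hG p q).1 ?_)), hb'eq.symm⟩
      rw [hp, hq]; exact hadj
    · exact Finset.mem_map.2 ⟨b₀, mem_srcBonds.2 (Or.inr rfl), hb⟩

omit [Fintype Λ] [Fintype Λ'] in
/-- Injective maps of finite sets preserve the meet-or-equal incompatibility. [folklore] -/
theorem polyInc_map_iff (A B : Finset Λ) : polyInc (A.map φ) (B.map φ) ↔ polyInc A B := by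
  unfold polyInc
  rw [← Finset.map_inter, Finset.map_nonempty, (Finset.map_injective φ).eq_iff]

/-- **Transport of the truncated functionals**: `Φ^T(φ C; ρ') = Φ^T(C; ρ)`. [cite: KoteckyPreiss1986, (3) (Φ^T only depends on the polymer system)] -/
theorem truncatedWeight_srcActivity_map (hG : ∀ p q, G'.Adj (φ p) (φ q) ↔ G.Adj p q) (hb : bondMapInj φ b₀ = b₀') (ε : ℂ)
    (C : Finset (Finset Λ)) :
    truncatedWeight polyInc (srcActivity G' β U μ b₀' ε) (C.map (Finset.mapEmbedding φ).toEmbedding) =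
      truncatedWeight polyInc (srcActivity G β U μ b₀ ε) C := by
  rw [Finset.map_eq_image]
  exact truncatedWeight_image (inc := polyInc) (inc' := polyInc) (Finset.map_injective φ).injOn
    (fun A _ B _ => polyInc_map_iff φ A B) (fun A _ => srcActivity_map_inj φ hG hb ε A)

omit [LinearOrder Λ] [LinearOrder Λ'] [Fintype Λ'] [DecidableRel G.Adj] [DecidableRel G'.Adj] in
/-- For a polymer inside the range of an injective map, mapping the preimage recovers it. [folklore] -/
theorem map_preimage_of_subset_rangeSites [DecidableEq Λ'] {A' : Finset Λ'} (h : A' ⊆ rangeSites φ) :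
    (A'.preimage φ φ.injective.injOn).map φ = A' := by
  ext x
  rw [Finset.mem_map]
  constructor
  · rintro ⟨a, ha, rfl⟩
    exact Finset.mem_preimage.1 ha
  · intro hx
    obtain ⟨a, -, rfl⟩ := Finset.mem_map.1 (h hx)
    exact ⟨a, Finset.mem_preimage.2 hx, rfl⟩

/-- **The main parts of two source gases agree under transport.** Let `φ : Λ ↪ Λ'` intertwine the
graphs (`G'.Adj (φ p) (φ q) ↔ G.Adj p q`) and the source bonds, let the degrees of `G'` be `≤ 4`,
`0 ≤ β ≤ β₀`, `|ε| ≤ β₀`, and let `ht : Λ' → ℕ` grow by at most one along the edges of `G'`, vanish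
at the sites of `b₀'`, and have its sub-level set `{ht < R}` inside the range of `φ`. Then the
anchored families of size `< R` of the two gases with non-zero truncated functional correspond
under `φ`, and `srcMain G' b₀' R ε = srcMain G b₀ R ε`.
[cite: Ueltschi1999, proof of Thm. 2.1 (ii) ("the sums converge uniformly in the volume")] -/
theorem srcMain_eq_of_transport (hdeg' : ∀ v : Λ', (Finset.univ.filter (G'.Adj v)).card ≤ 4)
    (hβ0 : 0 ≤ β) (hβ : β ≤ betaHT) {ε : ℂ} (hε : ‖ε‖ ≤ betaHT)
    (hG : ∀ p q, G'.Adj (φ p) (φ q) ↔ G.Adj p q) (hb : bondMapInj φ b₀ = b₀')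
    {ht : Λ' → ℕ} (hlip : ∀ a b, G'.Adj a b → ht b ≤ ht a + 1) (h1 : ht b₀'.1 = 0) (h2 : ht b₀'.2.1 = 0)
    {R : ℕ} (hR : ∀ u, ht u < R → u ∈ rangeSites φ) :
    srcMain G' β U μ b₀' R ε = srcMain G β U μ b₀ R ε := by
  classical
  set ρT := srcActivity G' β U μ b₀' ε with hρT
  -- the lift of families and its inverse
  set Ψ : Finset (Finset Λ) → Finset (Finset Λ') := fun C => C.map (Finset.mapEmbedding φ).toEmbedding with hΨ
  set Ψi : Finset (Finset Λ') → Finset (Finset Λ) := fun C' => C'.image fun A' => A'.preimage φ φ.injective.injOn with hΨi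
  have hΨmem : ∀ (C : Finset (Finset Λ)) (A' : Finset Λ'), A' ∈ Ψ C ↔ ∃ A ∈ C, A.map φ = A' := by
    intro C A'
    simp only [hΨ, Finset.mem_map, RelEmbedding.coe_toEmbedding, Finset.mapEmbedding_apply]
  have hpreimage_map : ∀ A : Finset Λ, (A.map φ).preimage φ φ.injective.injOn = A := fun A => by
    ext a
    rw [Finset.mem_preimage]
    exact Finset.mem_map' φ
  have hsizeΨ : ∀ C, famSize (Ψ C) = famSize C := fun C => by
    simp only [famSize, hΨ, Finset.sum_map, RelEmbedding.coe_toEmbedding, Finset.mapEmbedding_apply, Finset.card_map]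
  have hleft : ∀ C, Ψi (Ψ C) = C := fun C => by
    ext B
    simp only [hΨi, Finset.mem_image]
    constructor
    · rintro ⟨A', hA', rfl⟩
      obtain ⟨A, hA, rfl⟩ := (hΨmem C A').1 hA'
      rwa [hpreimage_map]
    · intro hB
      exact ⟨B.map φ, (hΨmem C _).2 ⟨B, hB, rfl⟩, hpreimage_map B⟩
  have hright : ∀ C' : Finset (Finset Λ'), clusterSupp C' ⊆ rangeSites φ → Ψ (Ψi C') = C' := fun C' hsupp => by
    have hpre : ∀ A'' ∈ C', (A''.preimage φ φ.injective.injOn).map φ = A'' := fun A'' hA'' =>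
      map_preimage_of_subset_rangeSites φ ((subset_clusterSupp hA'').trans hsupp)
    ext A'
    rw [hΨmem]
    simp only [hΨi, Finset.mem_image]
    constructor
    · rintro ⟨B, ⟨A'', hA'', rfl⟩, rfl⟩
      rwa [hpre A'' hA'']
    · intro hA'
      exact ⟨_, ⟨A', hA', rfl⟩, hpre A' hA'⟩
  -- index sets
  set T := ((srcFamilies b₀').filter (fun C => famSize C < R)).filter (fun C' => clusterSupp C' ⊆ rangeSites φ) with hT
  -- the main part of `G'` only involves families supported in the range
  have hsupp_of_ne : ∀ C' ∈ (srcFamilies b₀').filter (fun C => famSize C < R), truncatedWeight polyInc ρT C' ≠ 0 →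
      clusterSupp C' ⊆ rangeSites φ := by
    intro C' hC' hne w hw
    obtain ⟨hC', hsize⟩ := Finset.mem_filter.1 hC'
    exact hR w ((height_lt_of_mem_srcFamilies hdeg' hβ0 hβ hε hlip h1 h2 hC' hne hw).trans hsize)
  have hLHS : srcMain G' β U μ b₀' R ε = ∑ C' ∈ T, truncatedWeight polyInc ρT C' := by
    rw [hT]
    symm
    rw [Finset.sum_filter_of_ne hsupp_of_ne]
    rfl
  rw [hLHS, srcMain]
  symm
  refine Finset.sum_nbij' Ψ Ψi (fun C hC => ?_) (fun C' hC' => ?_) (fun C _ => hleft C) (fun C' hC' => ?_) (fun C _ => ?_)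
  · -- `Ψ C ∈ T`
    obtain ⟨hCfam, hCsize⟩ := Finset.mem_filter.1 hC
    obtain ⟨A, hAC, hA⟩ := mem_srcFamilies.1 hCfam
    refine Finset.mem_filter.2 ⟨Finset.mem_filter.2 ⟨mem_srcFamilies.2 ⟨A.map φ, (hΨmem C _).2 ⟨A, hAC, rfl⟩, ?_, ?_⟩, ?_⟩, ?_⟩
    · rw [← hb, bondMapInj_apply]; exact Finset.mem_map_of_mem φ hA.1
    · rw [← hb, bondMapInj_apply]; exact Finset.mem_map_of_mem φ hA.2
    · rw [hsizeΨ]; exact hCsize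
    · intro w hw
      obtain ⟨A', hA', hwA'⟩ := mem_clusterSupp.1 hw
      obtain ⟨B, -, rfl⟩ := (hΨmem C A').1 hA'
      obtain ⟨b, -, rfl⟩ := Finset.mem_map.1 hwA'
      exact Finset.mem_map_of_mem φ (Finset.mem_univ b)
  · -- `Ψi C' ∈ S`
    obtain ⟨hC'1, hsupp⟩ := Finset.mem_filter.1 hC'
    obtain ⟨hC'fam, hC'size⟩ := Finset.mem_filter.1 hC'1
    obtain ⟨A', hA'C', hA'⟩ := mem_srcFamilies.1 hC'fam
    refine Finset.mem_filter.2 ⟨mem_srcFamilies.2 ⟨A'.preimage φ φ.injective.injOn, Finset.mem_image_of_mem _ hA'C', ?_, ?_⟩, ?_⟩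
    · rw [Finset.mem_preimage]
      have hh := hA'.1
      rw [← hb, bondMapInj_apply] at hh
      exact hh
    · rw [Finset.mem_preimage]
      have hh := hA'.2
      rw [← hb, bondMapInj_apply] at hh
      exact hh
    · rw [← hsizeΨ, hright C' hsupp]
      exact hC'size
  · -- right inverse
    exact hright C' (Finset.mem_filter.1 hC').2
  · -- the terms agree
    exact (truncatedWeight_srcActivity_map φ hG hb ε C).symm

end Transport


/-! ## The torus with the source `(0̄, ȳ, σ)` and the comparison box of `ℤ²` -/

section Torus

/-- The image `z̄` of a lattice point `z ∈ ℤ²` in the fermionic torus of side `L`. [folklore] -/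
def torusPt (L : ℕ) [NeZero L] (z : Site 2) : FermionTorus 2 L := FermionTorus.ofTorusSite (Torus.proj L z)

/-- `toTorusSite (torusPt L z) = proj L z`. [folklore] -/
@[simp] theorem toTorusSite_torusPt (L : ℕ) [NeZero L] (z : Site 2) : (torusPt L z).toTorusSite = Torus.proj L z := by
  simp [torusPt]

/-- The source bond `(0̄, ȳ, σ)` of the torus. [cite: BenfattoGiulianiMastropietro2006, §1.2 (1.2) (the two-point Schwinger function)] -/
def torusSrc (L : ℕ) [NeZero L] (y : Site 2) (σ : Fin 2) : Bond (FermionTorus 2 L) := (torusPt L 0, torusPt L y, σ)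

/-- Vertices of the fermionic torus have at most `2d` neighbours. [folklore] -/
theorem card_filter_fermionTorusGraph_adj_le {d L : ℕ} [NeZero L] (v : FermionTorus d L) :
    (Finset.univ.filter ((fermionTorusGraph d L).Adj v)).card ≤ 2 * d := by
  classical
  have hsub : (Finset.univ.filter ((fermionTorusGraph d L).Adj v)).image FermionTorus.toTorusSite ⊆
      (Finset.univ : Finset (Fin d × Bool)).image fun p =>
        if p.2 then v.toTorusSite + Pi.single p.1 1 else v.toTorusSite - Pi.single p.1 1 := by
    intro z hz
    obtain ⟨w, hw, rfl⟩ := Finset.mem_image.1 hz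
    have hadj := (Finset.mem_filter.1 hw).2
    rw [fermionTorusGraph_adj, torusGraph_adj_iff] at hadj
    obtain ⟨-, ⟨i, h⟩ | ⟨i, h⟩⟩ := hadj
    · exact Finset.mem_image.2 ⟨(i, true), Finset.mem_univ _, by simp [h]⟩
    · refine Finset.mem_image.2 ⟨(i, false), Finset.mem_univ _, ?_⟩
      simp only [if_false, Bool.false_eq_true]
      rw [h, add_sub_cancel_right]
  have hinj : Function.Injective (FermionTorus.toTorusSite : FermionTorus d L → TorusSite d L) :=
    FermionTorus.equivTorusSite.injective
  calc (Finset.univ.filter ((fermionTorusGraph d L).Adj v)).card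
      = ((Finset.univ.filter ((fermionTorusGraph d L).Adj v)).image FermionTorus.toTorusSite).card :=
        (Finset.card_image_of_injective _ hinj).symm
    _ ≤ ((Finset.univ : Finset (Fin d × Bool)).image fun p =>
          if p.2 then v.toTorusSite + Pi.single p.1 1 else v.toTorusSite - Pi.single p.1 1).card := Finset.card_le_card hsub
    _ ≤ (Finset.univ : Finset (Fin d × Bool)).card := Finset.card_image_le
    _ = 2 * d := by rw [Finset.card_univ, Fintype.card_prod, Fintype.card_fin, Fintype.card_bool, mul_comm]

/-- Degrees of the two-dimensional fermionic torus are `≤ 4`. [folklore] -/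
theorem degree_torus_le (L : ℕ) [NeZero L] (v : FermionTorus 2 L) : (Finset.univ.filter ((fermionTorusGraph 2 L).Adj v)).card ≤ 4 :=
  card_filter_fermionTorusGraph_adj_le v

/-! ### The torus height: distance to `{0̄, ȳ}` -/

/-- `tnorm 0 = 0`. [folklore] -/
theorem tnorm_zero {d L : ℕ} [NeZero L] : Torus.tnorm (0 : TorusSite d L) = 0 := by
  have h : (0 : TorusSite d L) = Torus.proj L 0 := by funext i; simp
  have h0 : Site.supNorm (0 : Site d) = 0 := Site.supNorm_eq_zero_iff.2 rfl
  have := Torus.tnorm_proj_le (L := L) (0 : Site d)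
  rw [← h, h0] at this
  exact Nat.le_zero.1 this

/-- The torus height of a site: its torus distance to the nearer of `0̄` and `ȳ`. [folklore] -/
def torusHt (L : ℕ) [NeZero L] (y : Site 2) (u : FermionTorus 2 L) : ℕ :=
  min (Torus.tnorm u.toTorusSite) (Torus.tnorm (u.toTorusSite - Torus.proj L y))

/-- The torus height grows by at most one along an edge. [folklore] -/
theorem torusHt_le_succ_of_adj {L : ℕ} [NeZero L] (y : Site 2) {u v : FermionTorus 2 L} (h : (fermionTorusGraph 2 L).Adj u v) :
    torusHt L y v ≤ torusHt L y u + 1 := by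
  rw [fermionTorusGraph_adj] at h
  have h1 := Torus.tnorm_sub_le_succ_of_adj h 0
  have h2 := Torus.tnorm_sub_le_succ_of_adj h (Torus.proj L y)
  rw [sub_zero, sub_zero] at h1
  unfold torusHt
  omega

/-- The height vanishes at `0̄`. [folklore] -/
theorem torusHt_torusPt_zero {L : ℕ} [NeZero L] (y : Site 2) : torusHt L y (torusPt L 0) = 0 := by
  unfold torusHt
  rw [toTorusSite_torusPt, show Torus.proj L (0 : Site 2) = 0 by funext i; simp, tnorm_zero, Nat.zero_min]

/-- The height vanishes at `ȳ`. [folklore] -/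
theorem torusHt_torusPt_self {L : ℕ} [NeZero L] (y : Site 2) : torusHt L y (torusPt L y) = 0 := by
  unfold torusHt
  rw [toTorusSite_torusPt, sub_self, tnorm_zero, Nat.min_zero]

/-- The torus distance to `0̄` is at most the height plus `‖y‖_∞`. [folklore] -/
theorem tnorm_le_torusHt_add {L : ℕ} [NeZero L] (y : Site 2) (u : FermionTorus 2 L) :
    Torus.tnorm u.toTorusSite ≤ torusHt L y u + Site.supNorm y := by
  have htri : Torus.tnorm u.toTorusSite ≤ Torus.tnorm (u.toTorusSite - Torus.proj L y) + Torus.tnorm (Torus.proj L y) := by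
    have := Torus.tnorm_add_le (u.toTorusSite - Torus.proj L y) (Torus.proj L y)
    rwa [sub_add_cancel] at this
  have hy := Torus.tnorm_proj_le (L := L) y
  unfold torusHt
  omega

/-! ### The comparison box -/

/-- The side `M = R + ‖y‖_∞` of the comparison box. [folklore] -/
def Mbox (R : ℕ) (y : Site 2) : ℕ := R + Site.supNorm y

/-- `0 ∈ Λ_M`. [folklore] -/
theorem zero_mem_box (M : ℕ) : (0 : Site 2) ∈ box 2 M := by
  rw [mem_box_iff_supNorm_le, Site.supNorm_eq_zero_iff.2 rfl]
  exact Nat.zero_le M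

/-- `y ∈ Λ_{R + ‖y‖}`. [folklore] -/
theorem self_mem_box (R : ℕ) (y : Site 2) : y ∈ box 2 (Mbox R y) := by
  rw [mem_box_iff_supNorm_le, Mbox]
  exact Nat.le_add_left _ _

/-- The sites of the comparison box as a finite linearly ordered type (`PolySite`, lexicographic
order). [cite: Ueltschi1999, §2.3 (ρ(𝒜) is a trace over the sites of 𝒜)] -/
abbrev BoxSite (R : ℕ) (y : Site 2) : Type := PolySite (box 2 (Mbox R y))

/-- A point of the box as a site of `BoxSite`. [folklore] -/
def boxPt (R : ℕ) (y : Site 2) (z : Site 2) (hz : z ∈ box 2 (Mbox R y)) : BoxSite R y := ⟨toLex z, mem_lexSites.2 hz⟩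

/-- The source bond `(0, y, σ)` of the comparison box. [folklore] -/
def planeSrc (R : ℕ) (y : Site 2) (σ : Fin 2) : Bond (BoxSite R y) := (boxPt R y 0 (zero_mem_box _), boxPt R y y (self_mem_box R y), σ)

/-- Degrees in the comparison box are `≤ 4`. [folklore] -/
theorem degree_plane_le (R : ℕ) (y : Site 2) (v : BoxSite R y) : (Finset.univ.filter ((polyGraph (box 2 (Mbox R y))).Adj v)).card ≤ 4 :=
  card_filter_polyGraph_adj_le _ v

/-- Points of the box are in the box. [folklore] -/
theorem ofLex_mem_box {R : ℕ} {y : Site 2} (p : BoxSite R y) : ofLex p.1 ∈ box 2 (Mbox R y) := mem_lexSites.1 p.2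

/-- **The lift** of the comparison box into the torus of side `L > 2M`: `z ↦ z̄` (injective).
[cite: FriedliVelenik2017, §3.1] -/
def liftEmb (L : ℕ) [NeZero L] (R : ℕ) (y : Site 2) (hL : 2 * Mbox R y < L) : BoxSite R y ↪ FermionTorus 2 L :=
  ⟨fun p => torusPt L (ofLex p.1), fun p q h => by
    have hinj : Torus.proj L (ofLex p.1) = Torus.proj L (ofLex q.1) := by
      have := congrArg FermionTorus.toTorusSite h
      simpa [torusPt] using this
    have hb : ∀ j, |(ofLex p.1 : Site 2) j - (ofLex q.1 : Site 2) j| < L := fun j => by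
      have h1 : |(ofLex p.1 : Site 2) j - (ofLex q.1 : Site 2) j| ≤ 2 * Mbox R y := by
        have hp := (mem_box.1 (ofLex_mem_box p)) j
        have hq := (mem_box.1 (ofLex_mem_box q)) j
        rw [abs_le]; constructor <;> linarith [hp.1, hp.2, hq.1, hq.2]
      exact lt_of_le_of_lt h1 (by exact_mod_cast hL)
    have heq : (ofLex p.1 : Site 2) = ofLex q.1 := Torus.proj_injective_of_abs_sub_lt hb hinj
    exact Subtype.ext (by simpa using congrArg toLex heq)⟩

/-- `liftEmb` unfolded. [folklore] -/
@[simp] theorem liftEmb_apply {L : ℕ} [NeZero L] {R : ℕ} {y : Site 2} (hL : 2 * Mbox R y < L) (p : BoxSite R y) :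
    liftEmb L R y hL p = torusPt L (ofLex p.1) := rfl

/-- **The lift is a local graph isomorphism** (`2M + 1 < L`). [cite: FriedliVelenik2017, §3.1] -/
theorem liftEmb_adj_iff {L : ℕ} [NeZero L] {R : ℕ} {y : Site 2} (hL : 2 * Mbox R y + 1 < L) (p q : BoxSite R y) :
    (fermionTorusGraph 2 L).Adj (liftEmb L R y (Nat.lt_of_succ_lt hL) p) (liftEmb L R y (Nat.lt_of_succ_lt hL) q) ↔
      (polyGraph (box 2 (Mbox R y))).Adj p q := by
  rw [fermionTorusGraph_adj, liftEmb_apply, liftEmb_apply, toTorusSite_torusPt, toTorusSite_torusPt,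
    torusGraph_adj_proj_iff_of_mem_box hL (ofLex_mem_box p) (ofLex_mem_box q), polyGraph_adj]

/-- The lift maps the source bond of the box to the source bond of the torus. [folklore] -/
theorem bondMapInj_liftEmb_planeSrc {L : ℕ} [NeZero L] {R : ℕ} {y : Site 2} (hL : 2 * Mbox R y < L) (σ : Fin 2) :
    bondMapInj (liftEmb L R y hL) (planeSrc R y σ) = torusSrc L y σ := rfl

/-- **Near sites are lifted sites**: a torus site at torus distance `≤ M` from `0̄` is the lift of a
point of the box. [cite: FriedliVelenik2017, §3.1] -/
theorem mem_rangeSites_liftEmb {L : ℕ} [NeZero L] {R : ℕ} {y : Site 2} (hL : 2 * Mbox R y < L) {u : FermionTorus 2 L}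
    (hu : Torus.tnorm u.toTorusSite ≤ Mbox R y) : u ∈ rangeSites (liftEmb L R y hL) := by
  have hbox : Torus.cRep u.toTorusSite ∈ box 2 (Mbox R y) := Torus.cRep_mem_box_iff.2 hu
  refine Finset.mem_map.2 ⟨boxPt R y _ hbox, Finset.mem_univ _, ?_⟩
  rw [liftEmb_apply, boxPt]
  show torusPt L (ofLex (toLex (Torus.cRep u.toTorusSite))) = u
  rw [ofLex_toLex, torusPt, Torus.proj_cRep, FermionTorus.ofTorusSite_toTorusSite]

variable {β U μ : ℝ}

/-- Sites of torus height `< R` are lifts of points of the box `Λ_{R+‖y‖}` (`2M < L`). [cite: FriedliVelenik2017, §3.1] -/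
theorem mem_rangeSites_of_torusHt_lt {L : ℕ} [NeZero L] {R : ℕ} {y : Site 2} (hL : 2 * Mbox R y < L) {u : FermionTorus 2 L}
    (h : torusHt L y u < R) : u ∈ rangeSites (liftEmb L R y hL) := by
  refine mem_rangeSites_liftEmb hL ?_
  have h' := tnorm_le_torusHt_add y u
  rw [Mbox]
  omega

/-- **The main parts of the torus and of the comparison box agree** for `L > 2M + 1`, `0 ≤ β ≤ β₀`,
`|ε| ≤ β₀` (`srcMain_eq_of_transport` along the lift, with the torus distance to `{0̄, ȳ}` as
height). [cite: Ueltschi1999, proof of Thm. 2.1 (ii) ("the sums converge uniformly in the volume")] -/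
theorem srcMain_torus_eq_plane {L : ℕ} [NeZero L] {R : ℕ} {y : Site 2} {σ : Fin 2} (hL : 2 * Mbox R y + 1 < L)
    (hβ0 : 0 ≤ β) (hβ : β ≤ betaHT) {ε : ℂ} (hε : ‖ε‖ ≤ betaHT) :
    srcMain (fermionTorusGraph 2 L) β U μ (torusSrc L y σ) R ε = srcMain (polyGraph (box 2 (Mbox R y))) β U μ (planeSrc R y σ) R ε :=
  srcMain_eq_of_transport (liftEmb L R y (Nat.lt_of_succ_lt hL)) (degree_torus_le L) hβ0 hβ hε (liftEmb_adj_iff hL)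
    (bondMapInj_liftEmb_planeSrc _ σ) (fun _ _ hab => torusHt_le_succ_of_adj y hab) (torusHt_torusPt_zero y) (torusHt_torusPt_self y)
    fun _ hu => mem_rangeSites_of_torusHt_lt _ hu

end Torus

/-! ## Assembly: the Cauchy estimate and the limit -/

section Limit

variable {β U μ : ℝ}

/-- **The finite-volume two-point function of the fact is the derivative of the torus source gas at
zero**: `F_L'(0) = ⟨c†_{0̄σ} c_{ȳσ}⟩_{β,L}`. [cite: Ueltschi1999, proof of Thm. 2.1 (ii)] -/
theorem deriv_srcLogZ_torus {L : ℕ} [NeZero L] (y : Site 2) (σ : Fin 2) (hβ0 : 0 ≤ β) (hβ : β ≤ betaHT) :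
    deriv (srcLogZ (fermionTorusGraph 2 L) β U μ (torusSrc L y σ)) 0 = hubbardThermalTwoPoint β U μ L 0 y σ σ := by
  have h := deriv_srcLogZ_zero (U := U) (μ := μ) (b₀ := torusSrc L y σ) (degree_torus_le L) hβ0 hβ
  rw [h]
  unfold hubbardThermalTwoPoint
  rw [dif_neg (NeZero.ne L)]
  -- `convert`, not `rfl`: the `DecidableEq` instance terms synthesised inside the definition of
  -- `hubbardThermalTwoPoint` differ syntactically from those of the generic source gas
  -- (closed by `Subsingleton.elim`); `hubbardTorusWith` and `torusSrc` unfold by `rfl`.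
  convert rfl using 2
  all_goals rfl

/-- **Uniformity in the volume**: for `0 ≤ β ≤ β₀`, `|ε| ≤ β₀` and two tori of sides
`L, L' > 2(R + ‖y‖_∞) + 1`,
`|(F_L(ε) - F_L(0)) - (F_{L'}(ε) - F_{L'}(0))| ≤ 4 e^{-R}` (the main parts cancel, four tails remain).
[cite: Ueltschi1999, proof of Thm. 2.1 (ii) ("the sums converge uniformly in the volume")] -/
theorem norm_srcLogZ_sub_sub_le (hβ0 : 0 ≤ β) (hβ : β ≤ betaHT) {ε : ℂ} (hε : ‖ε‖ ≤ betaHT) (y : Site 2) (σ : Fin 2) (R : ℕ)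
    {L L' : ℕ} [NeZero L] [NeZero L'] (hL : 2 * Mbox R y + 1 < L) (hL' : 2 * Mbox R y + 1 < L') :
    ‖(srcLogZ (fermionTorusGraph 2 L) β U μ (torusSrc L y σ) ε - srcLogZ (fermionTorusGraph 2 L) β U μ (torusSrc L y σ) 0) -
      (srcLogZ (fermionTorusGraph 2 L') β U μ (torusSrc L' y σ) ε - srcLogZ (fermionTorusGraph 2 L') β U μ (torusSrc L' y σ) 0)‖ ≤
      4 * Real.exp (-R) := by
  have h0 : ‖(0 : ℂ)‖ ≤ betaHT := by rw [norm_zero]; exact betaHT_pos.le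
  rw [srcLogZ_sub_eq_main_add_tail R, srcLogZ_sub_eq_main_add_tail R, srcMain_torus_eq_plane hL hβ0 hβ hε,
    srcMain_torus_eq_plane hL hβ0 hβ h0, srcMain_torus_eq_plane hL' hβ0 hβ hε, srcMain_torus_eq_plane hL' hβ0 hβ h0]
  have t1 := norm_srcTail_le (U := U) (μ := μ) (b₀ := torusSrc L y σ) (degree_torus_le L) hβ0 hβ hε R
  have t2 := norm_srcTail_le (U := U) (μ := μ) (b₀ := torusSrc L y σ) (degree_torus_le L) hβ0 hβ h0 R
  have t3 := norm_srcTail_le (U := U) (μ := μ) (b₀ := torusSrc L' y σ) (degree_torus_le L') hβ0 hβ hε R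
  have t4 := norm_srcTail_le (U := U) (μ := μ) (b₀ := torusSrc L' y σ) (degree_torus_le L') hβ0 hβ h0 R
  calc _ = ‖(srcTail (fermionTorusGraph 2 L) β U μ (torusSrc L y σ) R ε - srcTail (fermionTorusGraph 2 L) β U μ (torusSrc L y σ) R 0) -
        (srcTail (fermionTorusGraph 2 L') β U μ (torusSrc L' y σ) R ε - srcTail (fermionTorusGraph 2 L') β U μ (torusSrc L' y σ) R 0)‖ := by
          congr 1; ring
    _ ≤ (‖srcTail (fermionTorusGraph 2 L) β U μ (torusSrc L y σ) R ε‖ + ‖srcTail (fermionTorusGraph 2 L) β U μ (torusSrc L y σ) R 0‖) +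
        (‖srcTail (fermionTorusGraph 2 L') β U μ (torusSrc L' y σ) R ε‖ + ‖srcTail (fermionTorusGraph 2 L') β U μ (torusSrc L' y σ) R 0‖) :=
          (norm_sub_le _ _).trans (add_le_add (norm_sub_le _ _) (norm_sub_le _ _))
    _ ≤ (Real.exp (-R) + Real.exp (-R)) + (Real.exp (-R) + Real.exp (-R)) := add_le_add (add_le_add t1 t2) (add_le_add t3 t4)
    _ = 4 * Real.exp (-R) := by ring

/-- **The Cauchy estimate**: `|⟨c†_{0̄σ}c_{ȳσ}⟩_{β,L} - ⟨c†_{0̄σ}c_{ȳσ}⟩_{β,L'}| ≤ 4e^{-R}/(β₀/2)` for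
`L, L' > 2(R + ‖y‖_∞) + 1`, `0 ≤ β ≤ β₀` (Cauchy's inequality for the derivative at `0` of the
difference of the two `F`'s on the circle `|ε| = β₀/2`). [cite: Ueltschi1999, proof of Thm. 2.1 (ii)] -/
theorem norm_hubbardThermalTwoPoint_sub_le (hβ0 : 0 ≤ β) (hβ : β ≤ betaHT) (y : Site 2) (σ : Fin 2) (R : ℕ)
    {L L' : ℕ} [NeZero L] [NeZero L'] (hL : 2 * Mbox R y + 1 < L) (hL' : 2 * Mbox R y + 1 < L') :
    ‖hubbardThermalTwoPoint β U μ L 0 y σ σ - hubbardThermalTwoPoint β U μ L' 0 y σ σ‖ ≤ 4 * Real.exp (-R) / (betaHT / 2) := by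
  set F : ℂ → ℂ := srcLogZ (fermionTorusGraph 2 L) β U μ (torusSrc L y σ) with hF
  set F' : ℂ → ℂ := srcLogZ (fermionTorusGraph 2 L') β U μ (torusSrc L' y σ) with hF'
  set g : ℂ → ℂ := fun ε => (F ε - F 0) - (F' ε - F' 0) with hg
  have hr : 0 < betaHT / 2 := half_pos betaHT_pos
  have hball : Metric.ball (0 : ℂ) betaHT ∈ 𝓝 (0 : ℂ) := Metric.ball_mem_nhds 0 betaHT_pos
  have hFd : DifferentiableOn ℂ F (Metric.ball 0 betaHT) := differentiableOn_srcLogZ (degree_torus_le L) hβ0 hβ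
  have hF'd : DifferentiableOn ℂ F' (Metric.ball 0 betaHT) := differentiableOn_srcLogZ (degree_torus_le L') hβ0 hβ
  have hgd : DifferentiableOn ℂ g (Metric.ball 0 betaHT) :=
    (hFd.sub (differentiableOn_const _)).sub (hF'd.sub (differentiableOn_const _))
  have hclosed : Metric.closedBall (0 : ℂ) (betaHT / 2) ⊆ Metric.ball 0 betaHT :=
    Metric.closedBall_subset_ball (by linarith [betaHT_pos])
  have hdiff : DiffContOnCl ℂ g (Metric.ball 0 (betaHT / 2)) := hgd.diffContOnCl_ball hclosed
  have hbound : ∀ z ∈ Metric.sphere (0 : ℂ) (betaHT / 2), ‖g z‖ ≤ 4 * Real.exp (-R) := by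
    intro z hz
    have hz' : ‖z‖ ≤ betaHT := by
      rw [mem_sphere_zero_iff_norm] at hz
      rw [hz]; linarith [betaHT_pos]
    exact norm_srcLogZ_sub_sub_le hβ0 hβ hz' y σ R hL hL'
  have hderiv : deriv g 0 = hubbardThermalTwoPoint β U μ L 0 y σ σ - hubbardThermalTwoPoint β U μ L' 0 y σ σ := by
    have hF0 : HasDerivAt F (deriv F 0) 0 := ((hFd.differentiableAt hball).hasDerivAt)
    have hF'0 : HasDerivAt F' (deriv F' 0) 0 := ((hF'd.differentiableAt hball).hasDerivAt)
    have hg0 : HasDerivAt g (deriv F 0 - deriv F' 0) 0 := by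
      have := (hF0.sub_const (F 0)).sub (hF'0.sub_const (F' 0))
      exact this
    rw [hg0.deriv, hF, hF', deriv_srcLogZ_torus y σ hβ0 hβ, deriv_srcLogZ_torus y σ hβ0 hβ]
  rw [← hderiv]
  exact Complex.norm_deriv_le_of_forall_mem_sphere_norm_le hr hdiff hbound

/-- **The equal-spin two-point function from `0` is a Cauchy sequence in the volume** for
`0 ≤ β ≤ β₀`. [cite: Ueltschi1999, Thm. 2.1 (ii)] -/
theorem cauchySeq_hubbardThermalTwoPoint_zero (hβ0 : 0 ≤ β) (hβ : β ≤ betaHT) (y : Site 2) (σ : Fin 2) :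
    CauchySeq fun L : ℕ => hubbardThermalTwoPoint β U μ L 0 y σ σ := by
  refine Metric.cauchySeq_iff'.2 fun η hη => ?_
  -- choose `R` with `4 e^{-R}/(β₀/2) < η`
  have hlim : Tendsto (fun R : ℕ => 4 * Real.exp (-(R : ℝ)) / (betaHT / 2)) atTop (𝓝 0) := by
    have h := (Real.tendsto_exp_neg_atTop_nhds_zero.comp tendsto_natCast_atTop_atTop)
    have := (h.const_mul 4).div_const (betaHT / 2)
    simpa using this
  obtain ⟨R, hR⟩ := (hlim.eventually (gt_mem_nhds hη)).exists
  refine ⟨2 * Mbox R y + 2, fun n hn => ?_⟩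
  haveI : NeZero n := ⟨by omega⟩
  haveI : NeZero (2 * Mbox R y + 2) := ⟨by omega⟩
  rw [dist_eq_norm]
  exact (norm_hubbardThermalTwoPoint_sub_le hβ0 hβ y σ R (by omega) (by omega)).trans_lt hR

/-- **The thermodynamic limit of the equal-spin two-point function from `0`** exists for
`0 ≤ β ≤ β₀` (all real `U, μ`, all `y`, `σ`). [cite: Ueltschi1999, Thm. 2.1 (ii)] -/
theorem exists_tendsto_hubbardThermalTwoPoint_zero (hβ0 : 0 ≤ β) (hβ : β ≤ betaHT) (U μ : ℝ) (y : Site 2) (σ : Fin 2) :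
    ∃ S : ℂ, Tendsto (fun L : ℕ => hubbardThermalTwoPoint β U μ L 0 y σ σ) atTop (𝓝 S) :=
  cauchySeq_tendsto_of_complete (cauchySeq_hubbardThermalTwoPoint_zero (U := U) (μ := μ) hβ0 hβ y σ)

end Limit

end SourceGas

/-! ## The high-temperature corner of `bgm_two_point_limit` -/

/-- **Thermodynamic limit of the Hubbard two-point function at high temperature** (Ueltschi 1999,
Thm. 2.1 (ii), for the two-dimensional Hubbard model with periodic boundary conditions): for
`0 ≤ β ≤ betaHT = (4 · 35² · e⁶)⁻¹` and ALL real `U, μ`, the finite-volume thermal two-point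
functions `⟨c†_{xσ} c_{yσ'}⟩_{β,L}` of the fact `bgm_two_point_limit` converge as `L → ∞`
(translation invariance reduces to `x = 0`; unequal spins give `0`).
[cite: Ueltschi1999, Thm. 2.1 (ii) and Thm. 3.1] -/
theorem exists_tendsto_hubbardThermalTwoPoint_of_le_betaHT {β : ℝ} (hβ0 : 0 ≤ β) (hβ : β ≤ SourceGas.betaHT) (U μ : ℝ)
    (x y : Site 2) (σ σ' : Fin 2) :
    ∃ S : ℂ, Tendsto (fun L : ℕ => hubbardThermalTwoPoint β U μ L x y σ σ') atTop (𝓝 S) := by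
  by_cases hσ : σ = σ'
  · subst hσ
    obtain ⟨S, hS⟩ := SourceGas.exists_tendsto_hubbardThermalTwoPoint_zero hβ0 hβ U μ (y - x) σ
    refine ⟨S, ?_⟩
    have hfun : (fun L : ℕ => hubbardThermalTwoPoint β U μ L x y σ σ) = fun L => hubbardThermalTwoPoint β U μ L 0 (y - x) σ σ :=
      funext fun L => hubbardThermalTwoPoint_eq_sub β U μ L x y σ σ
    rw [hfun]
    exact hS
  · exact ⟨0, tendsto_hubbardThermalTwoPoint_of_ne β U μ x y hσ⟩

/-- **The high-temperature corner of the fact `bgm_two_point_limit`, in its quantifier shape**: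
for every `μ` (and with `U₀, c` irrelevant) the conclusion of the fact — convergence of
`⟨c†_{xσ} c_{yσ'}⟩_{β,L}` as `L → ∞` — holds for all real `U` and all `0 < β ≤ betaHT`. This is the
part `β ≤ betaHT` of the fact's hypothesis region `0 < β ≤ e^{c/|U|}`; the remaining region
`betaHT < β ≤ e^{c/|U|}` is the content of the renormalisation-group analysis of
Benfatto–Giuliani–Mastropietro and is NOT proved here. [cite: Ueltschi1999, Thm. 2.1 (ii)] -/
theorem bgm_two_point_limit_of_le_betaHT :
    ∀ μ U β : ℝ, 0 < β → β ≤ SourceGas.betaHT →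
      ∀ (x y : Site 2) (σ σ' : Fin 2), ∃ S : ℂ,
        Tendsto (fun L : ℕ => hubbardThermalTwoPoint β U μ L x y σ σ') atTop (𝓝 S) :=
  fun μ U _ hβ hβ' x y σ σ' => exists_tendsto_hubbardThermalTwoPoint_of_le_betaHT hβ.le hβ' U μ x y σ σ'

end Literature.MathematicalPhysics.QuantumLattice

end
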